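import Summits.Ventures.Crystal3D.StickySpheres.Twelve33FromEleven
import HarnessLib

/-!
# `L(12,33) = {HC33}` from `{HC29}` and the CARRIED `(11, 28)` list of record (31 rows): kernel-checked cone certificate

Venture `Crystal3D` (cell `pub-crystal3d`, seat p3). `Twelve33FromEleven.lean` derives `CL(3,33,12; {HC33})` from
`S_11(29) = {HC29}`, `C(10) ≤ 25`, `C(11) ≤ 29` and the 30-row list `L28rows` (the `(11, 28)` stratum as decided by E1).
The cell's FINAL T(13) chain of record (p1 `step0/census/ext/final/chain/`, `L11-28-all.g6`, referee-certified in
`ref/CVALUES-n13.ok`) keeps ONE more graph in that stratum as an undecided member — graph6 `JoLSldMY^w?` (28 edges, ten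
vertices of degree 5 and one of degree 6; no realisation found, no refutation claimed) — so its `(11, 28)` list has 31 rows.
This file re-runs the same certificate with the 31-row list `L28cRows = L28rows ++ [L28carriedRow]` as hypothesis AND lookup
list: slice `d' = 4` = cones `HC29 ⊕ 4`, slice `d' = 5` = cones over the 10 tables of `L28cRows` with all row counts `≥ 4`
(the carried graph contributes all `462` of its 5-subsets); `817` cones pass the degree filter, `816` are refuted by
(histogram, triangle count, (degree, triangles) multiset) of a one-vertex deletion, and the remaining one is `HC33` by the
explicit permutation of `l33Poss`. Screen reproducing the kernel's decisions: `HOME/lean/conecert/carried12.py`.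

Results: `completeList_twelve33_of_HC29_L28c`, `completeList_twelve33_of_lists_carried`; bookkeeping between the two
list versions: `completeList_L28c_of_L28` (the 30-row hypothesis implies the 31-row one) and `completeList_L28_of_L28c`
(conversely, given `¬ RelaxedRealisable` of the carried graph). General helpers `tableSet_subset_append`,
`CompleteListHypothesis.of_append_absent`, and `testChainBlock` / `testChainMasks` (+ `testChainBlock_append`, `testChainBases_of_block`, `testChainMasks_append`,
`testChainBlock_one_of_masks`): the base block of ONE slice split into contiguous table blocks and one table's cones into mask
ranges, so that a heavy slice is verified in several kernel runs. HONEST FRAMING: hypotheses are not proved here; the 31-row list is the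
referee-certified chain output (interval/exact refutations by the cell's engines, not kernel facts); kernel computation
(`decide`), standard axioms.
-/

namespace Summit.Ventures.Crystal3D

open Finset SimpleGraph

-- The kernel certificates below are memory-heavy: elaborate this file's declarations one at a time.
set_option Elab.async false

/-! ### 1. Two list versions: generic bookkeeping -/

/-- The graphs of a list of tables are among the graphs of any extension of the list. [folklore] -/
theorem tableSet_subset_append {m : ℕ} (L M : List (List ℕ)) : tableSet m L ⊆ tableSet m (L ++ M) := by
  rintro X ⟨k, hk, rfl⟩
  refine ⟨k, by rw [List.length_append]; omega, ?_⟩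
  rw [List.getD_eq_getElem?_getD, List.getD_eq_getElem?_getD, List.getElem?_append_left hk]

/-- A complete list stays complete when tables are appended. [folklore] -/
theorem CompleteListHypothesis.append {d e m : ℕ} {L : List (List ℕ)} (M : List (List ℕ))
    (h : CompleteListHypothesis d e m (tableSet m L)) : CompleteListHypothesis d e m (tableSet m (L ++ M)) :=
  h.mono (tableSet_subset_append L M)

/-- **Dropping refuted tables:** if `L ++ M` is a complete list and every table of `M` is NOT relaxed-realisable, then `L`
alone is complete. [folklore] -/
theorem CompleteListHypothesis.of_append_absent {d e m : ℕ} {L M : List (List ℕ)}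
    (h : CompleteListHypothesis d e m (tableSet m (L ++ M)))
    (hM : ∀ k, k < M.length → ¬ RelaxedRealisable (tableGraph m (M.getD k []))) :
    CompleteListHypothesis d e m (tableSet m L) := by
  intro G _ he hd hG
  obtain ⟨H, ⟨k, hk, rfl⟩, ⟨φ⟩⟩ := h G he hd hG
  rw [List.length_append] at hk
  by_cases hkL : k < L.length
  · refine ⟨tableGraph m (L.getD k []), ⟨k, hkL, rfl⟩, ⟨?_⟩⟩
    rwa [List.getD_eq_getElem?_getD, List.getElem?_append_left hkL, ← List.getD_eq_getElem?_getD] at φ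
  · exfalso
    rw [not_lt] at hkL
    have hk' : k - L.length < M.length := by omega
    refine hM (k - L.length) hk' ?_
    rw [List.getD_eq_getElem?_getD, List.getElem?_append_right hkL, ← List.getD_eq_getElem?_getD] at φ
    exact hG.of_iso φ

/-! ### 1b. Splitting one slice of the base block into contiguous table blocks (separate kernel runs) -/

section Blocks

variable {m : ℕ}

variable (m) in
/-- The checks of `testChainBases` for the base tables `k0 ≤ k < k0 + len` of ONE slice `d'` (so that a heavy slice can be
verified table by table, each block in its own kernel run). [folklore] -/
def testChainBlock (d' e k0 len : ℕ) (bases look : ℕ → List (List ℕ)) (inv : ℕ → List (List ℕ × ℕ)) (lookDegs : List ℕ)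
    (tgt : List (List ℕ)) (poss : List (ℕ × ℕ × ℕ × ℕ × List ℕ × List ℕ)) : Bool :=
  (List.range len).all fun j =>
    tableOK (e - d') (adjOfRows ((bases d').getD (k0 + j) []) : Fin m → Fin m → Bool) &&
    (!minDegOK (d' - 1) (adjOfRows ((bases d').getD (k0 + j) []) : Fin m → Fin m → Bool) ||
    (List.range (2 ^ m)).all fun c =>
      testConeChain d' (k0 + j) c look inv lookDegs tgt poss (adjOfRows ((bases d').getD (k0 + j) []) : Fin m → Fin m → Bool)
        (maskFun c))

/-- Two adjacent blocks make one block. [folklore] -/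
theorem testChainBlock_append {d' e k0 l1 k1 l2 l : ℕ} {bases look : ℕ → List (List ℕ)} {inv : ℕ → List (List ℕ × ℕ)}
    {lookDegs : List ℕ} {tgt : List (List ℕ)} {poss : List (ℕ × ℕ × ℕ × ℕ × List ℕ × List ℕ)} (hk1 : k1 = k0 + l1)
    (hl : l = l1 + l2) (h1 : testChainBlock m d' e k0 l1 bases look inv lookDegs tgt poss = true)
    (h2 : testChainBlock m d' e k1 l2 bases look inv lookDegs tgt poss = true) :
    testChainBlock m d' e k0 l bases look inv lookDegs tgt poss = true := by
  subst hk1 hl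
  rw [testChainBlock, List.all_eq_true] at h1 h2 ⊢
  intro j hj
  rw [List.mem_range] at hj
  by_cases hj1 : j < l1
  · exact h1 j (List.mem_range.2 hj1)
  · obtain ⟨j', rfl⟩ : ∃ j', j = l1 + j' := ⟨j - l1, by omega⟩
    have h := h2 j' (List.mem_range.2 (by omega))
    rw [Nat.add_assoc] at h
    exact h

/-- A block covering all base tables of the slice `d'` gives the base block of `testChainBases` for that single slice.
[folklore] -/
theorem testChainBases_of_block {d' e l : ℕ} {bases look : ℕ → List (List ℕ)} {inv : ℕ → List (List ℕ × ℕ)}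
    {lookDegs : List ℕ} {tgt : List (List ℕ)} {poss : List (ℕ × ℕ × ℕ × ℕ × List ℕ × List ℕ)} (hl : (bases d').length = l)
    (h : testChainBlock m d' e 0 l bases look inv lookDegs tgt poss = true) :
    testChainBases m d' d' e bases look inv lookDegs tgt poss = true := by
  subst hl
  rw [testChainBlock, List.all_eq_true] at h
  rw [testChainBases, List.all_eq_true]
  intro i hi
  have hi0 : i = 0 := by have := List.mem_range.1 hi; omega
  subst hi0
  rw [Nat.add_zero, List.all_eq_true]
  intro k hk
  have hk' := h k hk
  simpa only [Nat.zero_add] using hk'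

variable (m) in
/-- The cone checks of ONE base table `k` of slice `d'` for the masks `c0 ≤ c < c0 + len` (so that one heavy table can be
verified in several kernel runs, each holding only its own share of the kernel's memory). [folklore] -/
def testChainMasks (d' k c0 len : ℕ) (bases look : ℕ → List (List ℕ)) (inv : ℕ → List (List ℕ × ℕ)) (lookDegs : List ℕ)
    (tgt : List (List ℕ)) (poss : List (ℕ × ℕ × ℕ × ℕ × List ℕ × List ℕ)) : Bool :=
  (List.range len).all fun i =>
    testConeChain d' k (c0 + i) look inv lookDegs tgt poss (adjOfRows ((bases d').getD k []) : Fin m → Fin m → Bool)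
      (maskFun (c0 + i))

/-- Two adjacent mask ranges make one. [folklore] -/
theorem testChainMasks_append {d' k c0 l1 c1 l2 l : ℕ} {bases look : ℕ → List (List ℕ)} {inv : ℕ → List (List ℕ × ℕ)}
    {lookDegs : List ℕ} {tgt : List (List ℕ)} {poss : List (ℕ × ℕ × ℕ × ℕ × List ℕ × List ℕ)} (hc1 : c1 = c0 + l1)
    (hl : l = l1 + l2) (h1 : testChainMasks m d' k c0 l1 bases look inv lookDegs tgt poss = true)
    (h2 : testChainMasks m d' k c1 l2 bases look inv lookDegs tgt poss = true) :
    testChainMasks m d' k c0 l bases look inv lookDegs tgt poss = true := by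
  subst hc1 hl
  rw [testChainMasks, List.all_eq_true] at h1 h2 ⊢
  intro i hi
  rw [List.mem_range] at hi
  by_cases hi1 : i < l1
  · exact h1 i (List.mem_range.2 hi1)
  · obtain ⟨i', rfl⟩ : ∃ i', i = l1 + i' := ⟨i - l1, by omega⟩
    have h := h2 i' (List.mem_range.2 (by omega))
    rw [Nat.add_assoc] at h
    exact h

/-- The full mask range `0 ≤ c < 2 ^ m` of a valid base table `k` is the one-table block `[k, k + 1)`. [folklore] -/
theorem testChainBlock_one_of_masks {d' e k N : ℕ} {bases look : ℕ → List (List ℕ)} {inv : ℕ → List (List ℕ × ℕ)}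
    {lookDegs : List ℕ} {tgt : List (List ℕ)} {poss : List (ℕ × ℕ × ℕ × ℕ × List ℕ × List ℕ)} (hN : N = 2 ^ m)
    (hOK : tableOK (e - d') (adjOfRows ((bases d').getD k []) : Fin m → Fin m → Bool) = true)
    (h : testChainMasks m d' k 0 N bases look inv lookDegs tgt poss = true) :
    testChainBlock m d' e k 1 bases look inv lookDegs tgt poss = true := by
  subst hN
  rw [testChainMasks, List.all_eq_true] at h
  rw [testChainBlock, List.all_eq_true]
  intro j hj
  have hj0 : j = 0 := by have := List.mem_range.1 hj; omega
  subst hj0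
  rw [Nat.add_zero, hOK, Bool.true_and, Bool.or_eq_true]
  refine Or.inr ?_
  rw [List.all_eq_true]
  intro c hc
  have hc' := h c hc
  simpa only [Nat.zero_add] using hc'

end Blocks

/-! ### 2. The carried `(11, 28)` list -/

/-- Row bitmasks of the carried graph `JoLSldMY^w?` (graph6 vertex order; 28 edges, degrees `5^10 6`). [folklore] -/
def L28carriedRow : List ℕ := [1222, 1825, 1681, 1264, 1804, 1354, 425, 589, 626, 406, 63]

/-- The 31-row `(11, 28)` list of record: `L28rows ++ [L28carriedRow]`. [folklore] -/
def L28cRows : List (List ℕ) := L28rows ++ [L28carriedRow]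

/-- Cached (degree histogram, ordered triangle count) of `L28cRows`. [folklore] -/
def L28cInv : List (List ℕ × ℕ) := L28inv ++ [([0, 0, 0, 0, 0, 10, 1, 0, 0, 0, 0, 0], 96)]

/-- The 30-row hypothesis implies the 31-row one. [folklore] -/
theorem completeList_L28c_of_L28 {d : ℕ} (h : CompleteListHypothesis d 28 11 (tableSet 11 L28rows)) :
    CompleteListHypothesis d 28 11 (tableSet 11 L28cRows) :=
  h.append [L28carriedRow]

/-- Conversely, the 31-row hypothesis and the non-realisability of the carried graph give the 30-row one. [folklore] -/
theorem completeList_L28_of_L28c {d : ℕ} (h : CompleteListHypothesis d 28 11 (tableSet 11 L28cRows))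
    (hJ : ¬ RelaxedRealisable (tableGraph 11 L28carriedRow)) : CompleteListHypothesis d 28 11 (tableSet 11 L28rows) :=
  h.of_append_absent fun k hk => by
    have hk0 : k = 0 := by simpa using hk
    subst hk0
    exact hJ

/-! ### 3. The certificate -/

/-- Lists per degree: `4 ↦ [HC29]`, `5 ↦ L28cRows`. [folklore] -/
def l33cLists : ℕ → List (List ℕ)
  | 4 => [HC29Data.rows]
  | 5 => L28cRows
  | _ => []

/-- Cached invariants per degree. [folklore] -/
def l33cInv : ℕ → List (List ℕ × ℕ)
  | 4 => HC29inv
  | 5 => L28cInv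
  | _ => []

set_option maxRecDepth 100000 in
set_option maxHeartbeats 20000000 in
/-- Certificate, slice `d' = 4` (cones `HC29 ⊕ 4`, lookups into `{HC29}` and `L28cRows`). Kernel computation (heartbeats and
recursion depth raised for the kernel run only). [folklore] -/
theorem l33c_slice4 : testChainBases 11 4 4 33 l33cLists l33cLists l33cInv [4, 5] [HC33rows] l33Poss = true := by
  decide +kernel

set_option maxRecDepth 100000 in
set_option maxHeartbeats 20000000 in
/-- Certificate, slice `d' = 5` (cones over the 10 tables of `L28cRows` with row counts `≥ 4`). Kernel computation.
[folklore] -/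
theorem l33c_slice5 : testChainBases 11 5 5 33 l33cLists l33cLists l33cInv [4, 5] [HC33rows] l33Poss = true := by
  decide +kernel

set_option maxHeartbeats 2000000 in
/-- Certificate, lookup tables (`29` resp. `28` edges, cached invariants correct). Kernel computation. [folklore] -/
theorem l33c_looks : testChainLooks 11 33 l33cLists l33cInv [4, 5] = true := by
  decide +kernel

/-- **`L(12,33) = {HC33}` from `{HC29}`, `C(10) ≤ 25`, `C(11) ≤ 29` and the 31-row list `L28cRows`.** [folklore] -/
theorem completeList_twelve33_of_HC29_L28c (h29 : CompleteListHypothesis 4 29 11 {HC29}) (h10 : maxContacts 3 10 ≤ 25)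
    (h11 : maxContacts 3 11 ≤ 29) (h28 : CompleteListHypothesis 3 28 11 (tableSet 11 L28cRows)) :
    CompleteListHypothesis 3 33 12 (tableSet 12 [HC33rows]) := by
  have h29' : CompleteListHypothesis 3 29 11 (tableSet 11 [HC29Data.rows]) := by
    rw [tableSet_HC29]
    exact CompleteListHypothesis.of_degree_floor (c := 25) h10 (by norm_num) h29 3
  have h4 : CompleteListHypothesis 4 33 12 (tableSet 12 [HC33rows]) := by
    refine completeList_of_testChain (m := 11) (d := 4) (D := 5) (e := 33) l33cLists l33cLists l33cInv [4, 5] [HC33rows]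
      l33Poss (by norm_num) (by norm_num) (testChain_of_blocks (testChainBases_cons l33c_slice4 l33c_slice5) l33c_looks
        (by decide +kernel)) ?_ ?_
    · intro d' h1 h2
      interval_cases d'
      · exact h29'
      · exact h28.of_le (by norm_num)
    · intro dw hdw
      simp only [List.mem_cons, List.not_mem_nil, or_false] at hdw
      rcases hdw with rfl | rfl
      · exact h29'
      · exact h28
  exact CompleteListHypothesis.of_degree_floor (c := 29) h11 (by norm_num) h4 3

/-- **`L(12,33) = {HC33}` from the `n = 10` STEP-0 lists, the rows `n ≤ 11`, and the 31-row list `L28cRows`.**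
[folklore] -/
theorem completeList_twelve33_of_lists_carried (h9 : GraphStratumHypothesis 4 22 9) (h21 : L21d4Complete)
    (h25 : CompleteListHypothesis 3 25 10 (tableSet 10 L25rows))
    (h24 : CompleteListHypothesis 3 24 10 (tableSet 10 L24rows))
    (h28 : CompleteListHypothesis 3 28 11 (tableSet 11 L28cRows)) :
    CompleteListHypothesis 3 33 12 (tableSet 12 [HC33rows]) :=
  completeList_twelve33_of_HC29_L28c (completeList_eleven29_of_L24_L25 h25 h24)
    (maxContacts_three_ten_of_lists' h9 h21).le (maxContacts_three_eleven_of_lists' h9 h21 h25).le h28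

end Summit.Ventures.Crystal3D
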